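import Literature.MathematicalPhysics.QuantumLattice.LiebMattisMatrixElements
import Literature.MathematicalPhysics.QuantumLattice.HeisenbergModelGlobalRotationProofs
import HarnessLib

/-!
# Cluster pair-cuts, piece [C](a): the spin-½ FLIP RULE — integer matrix of `4·Σ w_ij 𝐒_i·𝐒_j` in the configuration basis

HONEST FRAMING: ladder R1–R4 with certified numbers; no claim on H/H₀.  Cell pub-hubbard, lane r2-eng-1 (g12); design memo
`pub-hubbard-r2-eng-1/psdcert-g12/C-SPEC-g12.md` §3.  Infrastructure for the cluster pair-cut road ([C]): it certifies no cell by itself.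

For a weighted pair list `P = [(i, j, w), …]` on `N` spin-½ sites (`i ≠ j`), the operator `X_P = Σ_{(i,j,w) ∈ P} w • 𝐒_i·𝐒_j : Op (Fin N) 2`
has, in the configuration basis `σ : Fin N → Fin 2` (`0 = ↑`, `1 = ↓`), the entries `4·⟨σ|X_P|τ⟩ = xint4 P σ τ` where (Tasaki (2020) §2.4,
eq. (2.4.3) at `S = ½`):
* `σ = τ`: `Σ_(i,j,w) (+w if σ_i = σ_j, −w otherwise)` (`4·S^z_i S^z_j = ±1`);
* `σ ≠ τ`: `Σ_(i,j,w) (2w if σ_i ≠ σ_j and τ = σ with the values at i, j exchanged, 0 otherwise)` (`½(S⁺_i S⁻_j + S⁻_i S⁺_j)`).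
`xint4` is an INTEGER-valued computable function (`xint4Entry`), the object the kernel-side block builder of [C](c) evaluates; the theorem
`xint4Entry_eq` is its correctness against the tree's `spinDot`.  Tree inputs: `LiebMattis.spinDot_apply_self`, `LiebMattis.spinDot_apply_of_ne`,
`spinRaise_apply` (LiebMattisMatrixElements / SpinOperators).  All statements [folklore].
-/

namespace Summit.HubbardSuperconductivity.HubbardLadder.ClusterCut

open Matrix Complex Literature.MathematicalPhysics.QuantumLattice

variable {N : ℕ}

/-! ## §1 Spin-½ ladder entries -/

/-- `S⁺` for spin ½: `⟨k|S⁺|l⟩ = 1` iff `(k,l) = (0,1)`, else `0`. [folklore] -/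
theorem spinRaise_one_apply (k l : Fin 2) : spinRaise 1 k l = if k = 0 ∧ l = 1 then 1 else 0 := by
  rw [spinRaise_apply]
  fin_cases k <;> fin_cases l <;> simp

/-- `S⁻` for spin ½: `⟨k|S⁻|l⟩ = 1` iff `(k,l) = (1,0)`, else `0`. [folklore] -/
theorem spinLower_one_apply (k l : Fin 2) : spinLower 1 k l = if k = 1 ∧ l = 0 then 1 else 0 := by
  rw [spinLower, conjTranspose_apply, spinRaise_one_apply]
  fin_cases k <;> fin_cases l <;> simp

/-! ## §2 The flip rule for one pair -/

/-- Exchange the values of a configuration at two sites. [folklore] -/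
def swapAt (σ : Fin N → Fin 2) (i j : Fin N) : Fin N → Fin 2 :=
  fun z => if z = i then σ j else if z = j then σ i else σ z

/-- The integer `4·⟨σ| 𝐒_i·𝐒_j |τ⟩` for spin ½ (`i ≠ j`): `±1` on the diagonal by (anti)alignment, `2` for the exchange of an
antiparallel pair, `0` otherwise. [folklore] -/
def pairEntry4 (i j : Fin N) (σ τ : Fin N → Fin 2) : ℤ :=
  if σ = τ then (if σ i = σ j then 1 else -1)
  else if σ i ≠ σ j ∧ τ = swapAt σ i j then 2 else 0

/-- **Flip rule, one pair**: `4·⟨σ| 𝐒_i·𝐒_j |τ⟩ = pairEntry4 i j σ τ` for spin ½ and `i ≠ j`. Tasaki (2020) §2.4, eq. (2.4.3). [folklore] -/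
theorem four_mul_spinDot_apply {i j : Fin N} (hij : i ≠ j) (σ τ : Fin N → Fin 2) :
    (4 : ℂ) * spinDot 1 i j σ τ = (pairEntry4 i j σ τ : ℂ) := by
  by_cases hστ : σ = τ
  · subst hστ
    rw [LiebMattis.spinDot_apply_self 1 hij σ, pairEntry4, if_pos rfl]
    have hi : (σ i : ℕ) = 0 ∨ (σ i : ℕ) = 1 := by have := (σ i).isLt; omega
    have hj : (σ j : ℕ) = 0 ∨ (σ j : ℕ) = 1 := by have := (σ j).isLt; omega
    have e : (σ i = σ j) ↔ ((σ i : ℕ) = (σ j : ℕ)) := Fin.ext_iff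
    rcases hi with hi | hi <;> rcases hj with hj | hj <;>
      simp only [hi, hj, e, Nat.cast_zero, Nat.cast_one] <;> norm_num
  · rw [LiebMattis.spinDot_apply_of_ne 1 hij hστ, pairEntry4, if_neg hστ]
    by_cases hagree : ∀ z, z ≠ i → z ≠ j → σ z = τ z
    · rw [if_pos hagree, spinRaise_one_apply, spinLower_one_apply, spinRaise_one_apply, spinLower_one_apply]
      -- `τ = swapAt σ i j` iff the values at `i`, `j` are exchanged (given agreement elsewhere)
      have hswap : (τ = swapAt σ i j) ↔ (τ i = σ j ∧ τ j = σ i) := by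
        constructor
        · intro h
          have h1 := congrFun h i
          have h2 := congrFun h j
          simp only [swapAt, if_true, hij.symm, if_false] at h1 h2
          exact ⟨h1, h2⟩
        · rintro ⟨h1, h2⟩
          funext z
          simp only [swapAt]
          by_cases hz : z = i
          · subst hz; rw [if_pos rfl, h1]
          · rw [if_neg hz]
            by_cases hz' : z = j
            · subst hz'; rw [if_pos rfl, h2]
            · rw [if_neg hz', hagree z hz hz']
      -- if the values at i and j are NOT exchanged, σ and τ agree everywhere or the entry vanishes; case analysis on the four values
      have hneq : ¬(σ i = τ i ∧ σ j = τ j) := by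
        rintro ⟨h1, h2⟩
        apply hστ
        funext z
        by_cases hz : z = i
        · subst hz; exact h1
        · by_cases hz' : z = j
          · subst hz'; exact h2
          · exact hagree z hz hz'
      have vi : σ i = 0 ∨ σ i = 1 := by rcases (σ i) with ⟨v, hv⟩; interval_cases v <;> simp
      have vj : σ j = 0 ∨ σ j = 1 := by rcases (σ j) with ⟨v, hv⟩; interval_cases v <;> simp
      have ti : τ i = 0 ∨ τ i = 1 := by rcases (τ i) with ⟨v, hv⟩; interval_cases v <;> simp
      have tj : τ j = 0 ∨ τ j = 1 := by rcases (τ j) with ⟨v, hv⟩; interval_cases v <;> simp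
      rcases vi with vi | vi <;> rcases vj with vj | vj <;> rcases ti with ti | ti <;> rcases tj with tj | tj <;>
        simp only [vi, vj, ti, tj, hswap, and_true, and_self, one_ne_zero, zero_ne_one, if_true, if_false, ne_eq,
          not_true, not_false_eq_true, and_false] at hneq ⊢ <;>
        norm_num
    · rw [if_neg hagree]
      have hns : ¬(σ i ≠ σ j ∧ τ = swapAt σ i j) := by
        rintro ⟨-, h⟩
        apply hagree
        intro z hz hz'
        rw [h, swapAt, if_neg hz, if_neg hz']
      rw [if_neg hns]
      simp

/-! ## §3 Weighted pair lists -/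

/-- A weighted pair list on `N` sites: entries `(i, j, w)` with an integer weight. -/
abbrev PairList (N : ℕ) := List (Fin N × Fin N × ℤ)

/-- The operator `X_P = Σ_{(i,j,w) ∈ P} w • 𝐒_i·𝐒_j` on `N` spin-½ sites. [folklore] -/
noncomputable def pairOp (P : PairList N) : Op (Fin N) 2 :=
  (P.map fun p => ((p.2.2 : ℤ) : ℂ) • spinDot 1 p.1 p.2.1).sum

/-- The integer entry `4·⟨σ|X_P|τ⟩` computed by the flip rule. [folklore] -/
def xint4Entry (P : PairList N) (σ τ : Fin N → Fin 2) : ℤ :=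
  (P.map fun p => p.2.2 * pairEntry4 p.1 p.2.1 σ τ).sum

/-- **Flip rule for a weighted pair list**: `4·⟨σ|X_P|τ⟩ = xint4Entry P σ τ` when every listed pair has distinct sites. [folklore] -/
theorem xint4Entry_eq (P : PairList N) (hP : ∀ p ∈ P, p.1 ≠ p.2.1) (σ τ : Fin N → Fin 2) :
    (4 : ℂ) * pairOp P σ τ = (xint4Entry P σ τ : ℂ) := by
  induction P with
  | nil => simp [pairOp, xint4Entry]
  | cons p ps ih =>
    have hp : p.1 ≠ p.2.1 := hP p (by simp)
    have ih' := ih (fun q hq => hP q (by simp [hq]))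
    simp only [pairOp, xint4Entry, List.map_cons, List.sum_cons, Matrix.add_apply, Matrix.smul_apply, smul_eq_mul,
      Int.cast_add, Int.cast_mul] at ih' ⊢
    rw [mul_add, ih', ← four_mul_spinDot_apply hp σ τ]
    ring

/-- `X_P` is Hermitian (each `𝐒_i·𝐒_j` is, and the weights are real). [folklore] -/
theorem pairOp_isHermitian (P : PairList N) (hP : ∀ p ∈ P, p.1 ≠ p.2.1) : (pairOp P).IsHermitian := by
  induction P with
  | nil => simp [pairOp, Matrix.IsHermitian]
  | cons p ps ih =>
    have hp : p.1 ≠ p.2.1 := hP p (by simp)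
    have ih' := ih (fun q hq => hP q (by simp [hq]))
    simp only [pairOp, List.map_cons, List.sum_cons] at ih' ⊢
    refine Matrix.IsHermitian.add ?_ ih'
    have h := spinDot_isHermitian 1 p.1 p.2.1
    rw [Matrix.IsHermitian, conjTranspose_smul, h.eq, Complex.star_def, map_intCast]

/-- `X_P` commutes with every component of the total spin (`SU(2)` invariance; the hypothesis `hcomm` of
`ClusterCut.posSemidef_sub_smul_of_weightZero_spinHalf`). [folklore] -/
theorem pairOp_commute_totalSpin (P : PairList N) (α : Fin 3) :
    pairOp P * totalSpin 1 α = totalSpin 1 α * pairOp P := by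
  induction P with
  | nil => simp [pairOp]
  | cons p ps ih =>
    simp only [pairOp, List.map_cons, List.sum_cons] at ih ⊢
    rw [Matrix.add_mul, Matrix.mul_add, ih, Matrix.smul_mul, Matrix.mul_smul,
      (commute_spinDot_totalSpin 1 p.1 p.2.1 α).eq]

end Summit.HubbardSuperconductivity.HubbardLadder.ClusterCut
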